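import Literature.NumberTheory.Automorphic.CompletedCohomologyGL
import Literature.NumberTheory.Automorphic.CompletedCohomologyHeckeAlgebraGLnHolds
import Literature.NumberTheory.Automorphic.HeckeTowerCompatibility
import Literature.NumberTheory.Automorphic.GLnCuspidalSpectrumProofs
import HarnessLib

/-!
# The prime-to-`p` Hecke operators act on the completed cohomology of `GL_n`

Topic `NumberTheory/Automorphic`, namespace `Literature.NumberTheory.Automorphic.BigHeckeGLn`.

For an `S`-good tame level datum `𝒰 : TameLevel n K p` (`CompletedCohomologyHeckeAlgebraGLn`) and a
good place `v ∉ S` (so `v ∤ p`), the Hecke element `t_{v,i} = heckeElement n K v i` is supported at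
`v` while the levels `U_r` of the `p`-power tower differ only at the places above `p`.  We verify
the group-theoretic criterion `bijOn_doubleCosetQuot` of `HeckeTowerCompatibility` in this
situation (`TameLevel.bijOn_tower_heckeElement`: `U_{r'} t U_{r'} / U_{r'} → U_r t U_r / U_r` is a
bijection for `r ≤ r'`, using that `U` is factorizable at `v`, `TameLevel.mul_ofLocal_inv_mem`),
deduce that `t_{v,i}` is tower-compatible (`TameLevel.isTowerCompatible_heckeElement`), and obtain
**the Hecke operators `T_{v,i}` on Emerton's completed cohomology `H̃^j(K^p)_k` of `GL_n / K`**
(`TameLevel.completedHeckeT`), i.e. the action of the spherical Hecke operators away from `S` on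
`H̃^•` of [Emerton2006, §2.2], [CalegariEmerton2011, §5], through `completedHecke` of
`CompletedCohomology`.

The adelic bookkeeping (`ext_localComponent`, `localComponent_ofLocal`, `localComponent_ofLocal_of_ne`,
`mul_ofLocal_comm`, `heckeElement_eq_ofLocal`) is that of `CompletedCohomologyHeckeAlgebraGLnHolds`;
here only `localComponent_heckeElement_of_ne` (`(t_{v,i})_w = 1`, `w ≠ v`) is added.  The principal
congruence subgroups `localCongruenceSubgroup n K w r` (in which `mem_tower_iff` is stated) and their
neighbourhood-basis lemmas come from `GLnCuspidalSpectrumProofs`, imported HERE and not by the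
vocabulary file `CompletedCohomologyHeckeAlgebraGLn` (which writes the same subgroups as
`valuedCongruenceSubgroup (Fin n) (WithZero.exp (-r))`, definitionally equal, to keep its own import
cone light — see "Import discipline" there).

## References

* M. Emerton, Invent. Math. 164 (2006), §2.2 [Emerton2006].
* F. Calegari, M. Emerton, *Completed cohomology — a survey* (2012), §5 [CalegariEmerton2011].
-/

noncomputable section

open CategoryTheory
open scoped NumberField
open IsDedekindDomain

namespace Literature.NumberTheory.Automorphic

namespace BigHeckeGLn

variable {n : ℕ} {K : Type} [Field K] [NumberField K]

/-! ### Local components -/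

/-- The `w`-component of the Hecke element `t_{v,i}` is `1` for `w ≠ v` (it is supported at `v`).
[folklore] -/
theorem localComponent_heckeElement_of_ne {v w : HeightOneSpectrum (𝓞 K)} (h : w ≠ v) (i : ℕ) :
    localComponent n K w (heckeElement n K v i) = 1 := by
  rw [heckeElement_eq_ofLocal, localComponent_ofLocal_of_ne h]

/-! ### The tower of a tame level and the Hecke elements at good places -/

namespace TameLevel

variable {p : ℕ} [Fact p.Prime] (𝒰 : TameLevel n K p)

/-- Membership in `U_r`: `u ∈ U` and `u_w ≡ 1 (mod ϖ_w^r)` for every `w ∣ p` (definitional).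
[folklore] -/
theorem mem_tower_iff (r : ℕ) (u : FiniteAdelicGL n K) :
    u ∈ 𝒰.tower r ↔ u ∈ 𝒰.subgroup ∧ ∀ w : HeightOneSpectrum (𝓞 K), (p : 𝓞 K) ∈ w.asIdeal →
      localComponent n K w u ∈ localCongruenceSubgroup n K w r := by
  -- `tower` unfolded, with the congruence subgroups spelled `localCongruenceSubgroup` (definitional)
  show u ∈ 𝒰.subgroup ⊓ ⨅ v : {v : HeightOneSpectrum (𝓞 K) // (p : 𝓞 K) ∈ v.asIdeal},
      (localCongruenceSubgroup n K v.1 r).comap (localComponent n K v.1) ↔ _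
  simp only [Subgroup.mem_inf, Subgroup.mem_iInf, Subgroup.mem_comap, Subtype.forall]

variable {𝒰}

/-- A good place is not above `p`. [folklore] -/
theorem not_mem_asIdeal_of_not_mem_bad {v : HeightOneSpectrum (𝓞 K)} (hv : v ∉ 𝒰.bad) :
    (p : 𝓞 K) ∉ v.asIdeal :=
  fun h => hv (𝒰.mem_bad_of_mem v h)

/-- The `v`-part `ofLocal v (u_v)` of an element `u ∈ U` lies in every level `U_r` of the tower, for
a good place `v` (`U` is hyperspecial at `v` and the `U_r` only shrink above `p`). [folklore] -/
theorem ofLocal_localComponent_mem_tower {v : HeightOneSpectrum (𝓞 K)} (hv : v ∉ 𝒰.bad)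
    {u : FiniteAdelicGL n K} (hu : u ∈ 𝒰.subgroup) (r : ℕ) :
    ofLocal n K v (localComponent n K v u) ∈ 𝒰.tower r := by
  rw [mem_tower_iff]
  refine ⟨𝒰.ofLocal_mem v hv _ (localComponent_mem_valuedCongruenceSubgroup_one
    (𝒰.le_glFiniteIntegralLevel hu) v), fun w hw => ?_⟩
  have hwv : w ≠ v := fun h => not_mem_asIdeal_of_not_mem_bad hv (h ▸ hw)
  rw [localComponent_ofLocal_of_ne hwv]
  exact one_mem _

/-- **The double cosets of `t_{v,i}` are compatible along the tower**: for a good place `v` and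
`r ≤ r'`, the projection `G/U_{r'} → G/U_r` maps `U_{r'} t U_{r'} / U_{r'}` bijectively onto
`U_r t U_r / U_r`, `t = t_{v,i}` (criterion `bijOn_doubleCosetQuot`: `U_r = U_{r'} (U_r ∩ t U_r t⁻¹)`
via the `v`-part of an element, and `U_{r'} ∩ t U_r t⁻¹ ⊆ t U_{r'} t⁻¹` since conjugation by `t`
does not change the components above `p`). [folklore] -/
theorem bijOn_tower_heckeElement {v : HeightOneSpectrum (𝓞 K)} (hv : v ∉ 𝒰.bad) (i : ℕ)
    {r r' : ℕ} (h : r ≤ r') :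
    Set.BijOn (Subgroup.quotientMapOfLE (𝒰.tower_antitone h))
      (ArithmeticQuotient.doubleCosetQuot (𝒰.tower r') (heckeElement n K v i))
      (ArithmeticQuotient.doubleCosetQuot (𝒰.tower r) (heckeElement n K v i)) := by
  have ht : ∀ w ≠ v, localComponent n K w (heckeElement n K v i) = 1 :=
    fun w hw => localComponent_heckeElement_of_ne hw i
  refine ArithmeticQuotient.bijOn_doubleCosetQuot (𝒰.tower_antitone h) _ (fun l hl => ?_)
    (fun l' hl' hc => ?_)
  · -- (a) `l = l' · (t m t⁻¹)` with `l' = v`-part of `l`, `m = l'⁻¹ l`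
    have hlU : l ∈ 𝒰.subgroup := 𝒰.tower_le r hl
    set l' := ofLocal n K v (localComponent n K v l) with hl'def
    have hm1 : localComponent n K v (l'⁻¹ * l) = 1 := by
      rw [map_mul, map_inv, hl'def, localComponent_ofLocal, inv_mul_cancel]
    have hcomm : l'⁻¹ * l * heckeElement n K v i = heckeElement n K v i * (l'⁻¹ * l) := by
      rw [heckeElement_eq_ofLocal]
      exact mul_ofLocal_comm hm1 _
    have hconj : (heckeElement n K v i)⁻¹ * (l'⁻¹ * l) * heckeElement n K v i = l'⁻¹ * l := by
      rw [mul_assoc, hcomm, ← mul_assoc, inv_mul_cancel, one_mul]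
    refine ⟨l', ofLocal_localComponent_mem_tower hv hlU r',
      (heckeElement n K v i)⁻¹ * (l'⁻¹ * l) * heckeElement n K v i, ?_, ?_⟩
    · rw [hconj]
      exact mul_mem (inv_mem (ofLocal_localComponent_mem_tower hv hlU r)) hl
    · group
  · -- (b) conjugation by `t` does not change membership in the deeper level
    rw [mem_tower_iff] at hl' hc ⊢
    refine ⟨hc.1, fun w hw => ?_⟩
    have hwv : w ≠ v := fun h' => not_mem_asIdeal_of_not_mem_bad hv (h' ▸ hw)
    rw [map_mul, map_mul, map_inv, ht w hwv, inv_one, one_mul, mul_one]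
    exact hl'.2 w hw

/-- **`t_{v,i}` is tower-compatible** for a good place `v`: its Hecke operators commute with all
pull-backs of the `p`-power tower (`isTowerCompatible_of_bijOn` with the finiteness of the double
cosets of the compact open `U_r`). [cite: Emerton2006, §2.2] -/
theorem isTowerCompatible_heckeElement (k : Type) [CommRing k] {v : HeightOneSpectrum (𝓞 K)}
    (hv : v ∉ 𝒰.bad) (i : ℕ) :
    IsTowerCompatible k (globalEmbedding n K) 𝒰.levelTower (p : k) (heckeElement n K v i) :=
  isTowerCompatible_of_bijOn k (globalEmbedding n K) 𝒰.levelTower (p : k) _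
    (fun h => bijOn_tower_heckeElement hv i h) fun r => finite_orbit_quotient (𝒰.tower r) _

variable (𝒰) (k : Type) [CommRing k]

/-- **The Hecke operator `T_{v,i}` on the completed cohomology `H̃^j(K^p)_k` of `GL_n / K`** for a
good place `v ∉ S`: the compatible family of the finite-level operators `[U_r t_{v,i} U_r]`
(`completedHecke` of `CompletedCohomology` for the tower-compatible `t_{v,i}`) — the action of the
spherical Hecke operators away from `S` on `H̃^•` [Emerton2006, §2.2], [CalegariEmerton2011, §5].
[cite: CalegariEmerton2011, §5] -/
def completedHeckeT {v : HeightOneSpectrum (𝓞 K)} (hv : v ∉ 𝒰.bad) (i j : ℕ) :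
    Module.End k (𝒰.completedCohomology k j) :=
  completedHecke (isTowerCompatible_heckeElement k hv i) j

end TameLevel

end BigHeckeGLn

end Literature.NumberTheory.Automorphic
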